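import Summits.KontsevichZagierPeriods.Zeta5Search.Certificates.RecordRayDenominatorsAtlas33
import Summits.KontsevichZagierPeriods.Zeta5Search.Denom.RecordRayBrickCells
import HarnessLib

/-!
# ζ(5) search — the record ray's DENOMINATORS, XI: a TABLE-DRIVEN window atlas consuming the brick cells (p3 g5)

HONEST FRAMING: systematic search; no irrationality claim unless certified.

OUR work (Summit side; prover seat p3, generation 5).  The consumer side of fam-denom's PHIPORT
(`Denom.RecordRayBrickCells.brick_cell`: Zudilin's (8.11) brick exponent `2c` on every certified `ν`-cell, in the
hypothesis/conclusion shape of `cell_core`), merged with the 33-window atlas of file X-d.  Instead of one lemma per window,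
a window is a RECORD `BWin` = `(a₁/a₂, b₁/b₂]·n` with exponent `k` and a SOURCE — either a sub-window of atlas33 window
`idx` (`kind = 0`, `k ≤ wQv idx`) or the brick cell `nuCells[idx]` at the integer shift `m` (`kind = 1`, `k ≤ 2c`,
`θ = p/n ∈ (b₁ᶜ/(m b₁ᶜ + a₁ᶜ), b₀ᶜ/(m b₀ᶜ + a₀ᶜ))`) — and

* `BWin.ok` is a Boolean CHECK of the source's side conditions (table arithmetic, decidable), `BWin.dvd_of_ok` its
  soundness: for every prime of an `ok` window, `p^k` divides the multiplied wedge and the multiplied Q-minor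
  (`windowsV_dvd` of file X-d, resp. `brick_cell`; primes on a cell boundary are impossible: `p ∣ b₀n` with `b₀ ≤ 41 < p`
  and `p ∣ n ⇒ b₀ ∣ a₀`, `0 < a₀ < b₀`);
* for any LIST `l` of windows with `l.all ok`, consecutive separation `chainSep l` (a Boolean) and rate
  `rateQ l = Σ k (B − A) ∈ ℚ`: the multiplier `ML l n = M0 n / Φ_n(l)` has `ML·P_n, ML·Q(a·n) ∈ ℤ` (`n ≥ 10496`, so that
  `p > n/16 ⇒ p² > 41n`), `ML l n ≤ e^{(381.5232 − rateQ l + ε)n}`, and `record_exponent_of_table`: every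
  `γ ≥ 0` with `γ·(381.5232 − rateQ l + 0.02 + 85.08768884) < 116.63288883` is a hypothesis-free effective exponent.

A table file then only lists windows and runs `decide`.  Valuation bookkeeping; every `γ < 1` — no irrationality content.
-/

noncomputable section

open Finset Real Filter Topology

namespace Summit.KontsevichZagierPeriods.Zeta5Search.RecordRay

open Summit.KontsevichZagierPeriods.Zeta5Search.DualSeries
open Summit.KontsevichZagierPeriods.Zeta5Search.DualSeriesDenominators
open Summit.KontsevichZagierPeriods.Zeta5Search.WedgeDictionary
open Summit.KontsevichZagierPeriods.Zeta5Search.DualSeriesLemma19 (bRecord)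
open Summit.KontsevichZagierPeriods.Zeta5Search.CasoratianValuation (casoratian shift)
open Summit.KontsevichZagierPeriods.Zeta5Search.Denom.DigitCert (Cell)
open Summit.KontsevichZagierPeriods.Zeta5Search.Denom.RecordRayNuCells (nuCells)
open Summit.KontsevichZagierPeriods.Zeta5Search.Denom.RecordRayBrickCells (brick_cell)
open Literature.NumberTheory.Irrationality.Hata1992
open Literature.NumberTheory.Transcendental (zetaValue)

/-- One window of a table-driven atlas: `(a₁/a₂ · n, b₁/b₂ · n]`, exponent `k`, source `kind` (`0` = sub-window of
atlas33 window `idx`; `1` = brick cell `nuCells[idx]` at shift `m`). -/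
structure BWin where
  /-- left endpoint numerator -/
  a1 : ℕ
  /-- left endpoint denominator -/
  a2 : ℕ
  /-- right endpoint numerator -/
  b1 : ℕ
  /-- right endpoint denominator -/
  b2 : ℕ
  /-- exponent removed on the window -/
  k : ℕ
  /-- source kind: `0` atlas33, `1` brick cell -/
  kind : ℕ
  /-- source index (atlas33 window / cell number) -/
  idx : ℕ
  /-- integer shift of the cell (`x = n/p − m`) -/
  m : ℕ

namespace BWin

/-- Left endpoint `a₁/a₂ ∈ ℚ`. -/
def Aq (w : BWin) : ℚ := (w.a1 : ℚ) / w.a2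

/-- Right endpoint `b₁/b₂ ∈ ℚ`. -/
def Bq (w : BWin) : ℚ := (w.b1 : ℚ) / w.b2

/-- Shape conditions: positive data, `A ≤ B`, `A ≥ 1/16` (so `p > n/16`), `B ≤ 41` (so `p ≤ 41n`). -/
def okShape (w : BWin) : Bool :=
  decide (0 < w.a1) && decide (0 < w.a2) && decide (0 < w.b2) && decide (w.a1 * w.b2 ≤ w.b1 * w.a2) &&
    decide (w.a2 ≤ 16 * w.a1) && decide (w.b1 ≤ 41 * w.b2)

/-- Source check, kind `0`: a sub-window of atlas33 window `idx` with `k ≤ wQv idx`. -/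
def okAtlas (w : BWin) : Bool :=
  (w.kind == 0) &&
    (if h : w.idx < 33 then
      decide (AZv ⟨w.idx, h⟩ * w.a2 ≤ 79560 * w.a1) && decide (79560 * w.b1 ≤ BZv ⟨w.idx, h⟩ * w.b2) &&
        decide (w.k ≤ wQv ⟨w.idx, h⟩)
    else false)

/-- Source check, kind `1`: the window lies in brick cell `nuCells[idx]` shifted by `m`
(`b₁ᶜ·a₂ ≤ (a₁ᶜ + m b₁ᶜ)·a₁` and `(a₀ᶜ + m b₀ᶜ)·b₁ ≤ b₀ᶜ·b₂`), `k ≤ 2c`, and the cell data used by the boundary argument. -/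
def okBrick (w : BWin) : Bool :=
  (w.kind == 1) &&
    match nuCells[w.idx]? with
    | some C =>
        decide (0 < C.a0) && decide (C.a0 < (C.b0 : ℤ)) && decide (C.b0 ≤ 41) && decide (0 < C.a1) &&
          decide ((C.b1 : ℤ) * w.a2 ≤ (C.a1 + w.m * C.b1) * w.a1) &&
          decide ((C.a0 + w.m * C.b0) * w.b1 ≤ (C.b0 : ℤ) * w.b2) && decide ((w.k : ℤ) ≤ 2 * C.c)
    | none => false

/-- The full check of a window. -/
def ok (w : BWin) : Bool := w.okShape && (w.okAtlas || w.okBrick)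

section Sound

variable {n p : ℕ}

/-- Soundness, kind `0`: a prime of a sub-window of atlas33 window `j` is a prime of that window (`windowsV_dvd`). -/
theorem dvd_of_okAtlas {w : BWin} (hs : w.okShape = true) (h : w.okAtlas = true) (hn : 47 ≤ n) (hp : p.Prime)
    (hlo : w.a1 * n < w.a2 * p) (hhi : w.b2 * p ≤ w.b1 * n)
    {zW zV zW' zV' zU zU' : ℤ}
    (hzW : dRec n ^ 3 * sharpNormaliser (bRecord n) * coeffW (bRecord n) = zW)
    (hzV : dRec n ^ 6 * sharpNormaliser (bRecord n) * coeffV (bRecord n) = zV)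
    (hzW' : dRec n ^ 3 * sharpNormaliser (bRecord' n) * coeffW (bRecord' n) = zW')
    (hzV' : dRec n ^ 6 * sharpNormaliser (bRecord' n) * coeffV (bRecord' n) = zV')
    (hzU : dRec n * sharpNormaliser (bRecord n) * coeffU (bRecord n) = zU)
    (hzU' : dRec n * sharpNormaliser (bRecord' n) * coeffU (bRecord' n) = zU') :
    (p : ℤ) ^ w.k ∣ (zW' * zV - zW * zV') ∧
    (p : ℤ) ^ w.k ∣ ((Nat.lcmUpto (41 * n) : ℤ) ^ 5 * (zU * zW') - (Nat.lcmUpto (41 * n) : ℤ) ^ 5 * (zU' * zW)) := by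
  simp only [okAtlas, Bool.and_eq_true, beq_iff_eq] at h
  obtain ⟨-, h⟩ := h
  split at h
  · rename_i hidx
    simp only [Bool.and_eq_true, decide_eq_true_eq] at h
    obtain ⟨⟨hL, hR⟩, hk⟩ := h
    simp only [okShape, Bool.and_eq_true, decide_eq_true_eq] at hs
    obtain ⟨⟨⟨⟨⟨-, ha2⟩, hb2⟩, -⟩, -⟩, -⟩ := hs
    set j : Fin 33 := ⟨w.idx, hidx⟩
    have ha2' : (0 : ℝ) < w.a2 := by exact_mod_cast ha2
    have hb2' : (0 : ℝ) < w.b2 := by exact_mod_cast hb2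
    have hmem : p ∈ windowPrimes (AwinV j) (BwinV j) n := by
      rw [mem_windowPrimes_iff (AwinV_le_BwinV j (mem_univ _)).1]
      refine ⟨hp, ?_, ?_⟩
      · unfold AwinV
        have h1 : ((AZv j : ℕ) : ℝ) * w.a2 ≤ 79560 * w.a1 := by exact_mod_cast hL
        have h2 : (w.a1 : ℝ) * n < w.a2 * p := by exact_mod_cast hlo
        rw [div_mul_eq_mul_div, div_lt_iff₀ (by norm_num : (0 : ℝ) < 79560)]
        have key : ((AZv j : ℕ) : ℝ) * n * w.a2 < p * 79560 * w.a2 := by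
          nlinarith [mul_le_mul_of_nonneg_right h1 (Nat.cast_nonneg n)]
        exact lt_of_mul_lt_mul_right key ha2'.le
      · unfold BwinV
        have h1 : (79560 : ℝ) * w.b1 ≤ (BZv j : ℝ) * w.b2 := by exact_mod_cast hR
        have h2 : (w.b2 : ℝ) * p ≤ w.b1 * n := by exact_mod_cast hhi
        rw [div_mul_eq_mul_div, le_div_iff₀ (by norm_num : (0 : ℝ) < 79560)]
        have key : (p : ℝ) * 79560 * w.b2 ≤ (BZv j : ℝ) * n * w.b2 := by
          nlinarith [mul_le_mul_of_nonneg_right h1 (Nat.cast_nonneg n)]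
        exact le_of_mul_le_mul_right key hb2'
    obtain ⟨d1, d2⟩ := windowsV_dvd hn hzW hzV hzW' hzV' hzU hzU' j (mem_univ _) p hmem
    exact ⟨(pow_dvd_pow _ hk).trans d1, (pow_dvd_pow _ hk).trans d2⟩
  · exact absurd h Bool.false_ne_true

/-- Soundness, kind `1`: a prime of a window inside the shifted cell `nuCells[idx] + m` gets `p^{2c}` from `brick_cell`
(`n ≥ 10496 = 41·16²` makes `41n < p²` for `p > n/16`; the right cell boundary is never a prime of the window). -/
theorem dvd_of_okBrick {w : BWin} (hs : w.okShape = true) (h : w.okBrick = true) (hn : 10496 ≤ n) (hp : p.Prime)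
    (hlo : w.a1 * n < w.a2 * p) (hhi : w.b2 * p ≤ w.b1 * n)
    {zW zV zW' zV' zU zU' : ℤ}
    (hzW : dRec n ^ 3 * sharpNormaliser (bRecord n) * coeffW (bRecord n) = zW)
    (hzV : dRec n ^ 6 * sharpNormaliser (bRecord n) * coeffV (bRecord n) = zV)
    (hzW' : dRec n ^ 3 * sharpNormaliser (bRecord' n) * coeffW (bRecord' n) = zW')
    (hzV' : dRec n ^ 6 * sharpNormaliser (bRecord' n) * coeffV (bRecord' n) = zV')
    (hzU : dRec n * sharpNormaliser (bRecord n) * coeffU (bRecord n) = zU)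
    (hzU' : dRec n * sharpNormaliser (bRecord' n) * coeffU (bRecord' n) = zU') :
    (p : ℤ) ^ w.k ∣ (zW' * zV - zW * zV') ∧
    (p : ℤ) ^ w.k ∣ ((Nat.lcmUpto (41 * n) : ℤ) ^ 5 * (zU * zW') - (Nat.lcmUpto (41 * n) : ℤ) ^ 5 * (zU' * zW)) := by
  simp only [okBrick, Bool.and_eq_true, beq_iff_eq] at h
  obtain ⟨-, h⟩ := h
  split at h
  · rename_i C hC
    simp only [Bool.and_eq_true, decide_eq_true_eq] at h
    obtain ⟨⟨⟨⟨⟨⟨ha0, hab0⟩, hb041⟩, ha1c⟩, hL⟩, hR⟩, hk⟩ := h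
    simp only [okShape, Bool.and_eq_true, decide_eq_true_eq] at hs
    obtain ⟨⟨⟨⟨⟨ha1, ha2⟩, hb2⟩, -⟩, h8⟩, h41⟩ := hs
    have hCmem : C ∈ nuCells := List.mem_iff_getElem?.mpr ⟨w.idx, hC⟩
    have hn1 : 1 ≤ n := by omega
    have hp8 : n < 16 * p := by
      have : w.a1 * n < w.a1 * (16 * p) := by nlinarith
      exact Nat.lt_of_mul_lt_mul_left this
    have hp41 : 41 < p := by omega
    have hpn : p ≤ 41 * n := by
      have : w.b2 * p ≤ w.b2 * (41 * n) := by nlinarith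
      exact Nat.le_of_mul_le_mul_left this hb2
    have hsq : 41 * n < p ^ 2 := by
      have h64 : n * n < (16 * p) * (16 * p) := Nat.mul_lt_mul'' hp8 hp8
      nlinarith
    have hx1 : (C.b1 : ℤ) * ((n : ℤ) - w.m * p) < C.a1 * (p : ℤ) := by
      have hlo' : (w.a1 : ℤ) * n < w.a2 * p := by exact_mod_cast hlo
      have ha2pos : (0 : ℤ) < w.a2 := by exact_mod_cast ha2
      have hsum : (0 : ℤ) < C.a1 + w.m * C.b1 := by positivity
      have key : ((C.b1 : ℤ) * n) * w.a2 < ((C.a1 + w.m * C.b1) * p) * w.a2 := by nlinarith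
      have := lt_of_mul_lt_mul_right key ha2pos.le
      linarith
    have hx0 : C.a0 * (p : ℤ) < (C.b0 : ℤ) * ((n : ℤ) - w.m * p) := by
      have hhi' : (w.b2 : ℤ) * p ≤ w.b1 * n := by exact_mod_cast hhi
      have hb2pos : (0 : ℤ) < w.b2 := by exact_mod_cast hb2
      have hsum : (0 : ℤ) < C.a0 + w.m * C.b0 := by positivity
      have key : ((C.a0 + w.m * C.b0) * p) * w.b2 ≤ ((C.b0 : ℤ) * n) * w.b2 := by nlinarith
      have hle : (C.a0 + w.m * C.b0) * (p : ℤ) ≤ (C.b0 : ℤ) * n := le_of_mul_le_mul_right key hb2pos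
      rcases hle.lt_or_eq with hlt | heq
      · linarith
      · exfalso
        have hdvd : (p : ℤ) ∣ (C.b0 : ℤ) * n := ⟨C.a0 + w.m * C.b0, by rw [← heq]; ring⟩
        have hdvdN : p ∣ C.b0 * n := by exact_mod_cast hdvd
        rcases (Nat.Prime.dvd_mul hp).1 hdvdN with h1 | h1
        · exact absurd (Nat.le_of_dvd (by omega) h1) (by omega)
        · obtain ⟨q, hq⟩ := h1
          have hp0 : (p : ℤ) ≠ 0 := by exact_mod_cast hp.pos.ne'
          have e2 : (C.a0 + w.m * C.b0) * (p : ℤ) = ((C.b0 : ℤ) * q) * p := by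
            rw [heq, hq]; push_cast; ring
          have e3 := mul_right_cancel₀ hp0 e2
          have e4 : C.a0 = (C.b0 : ℤ) * ((q : ℤ) - w.m) := by linear_combination e3
          rcases lt_or_ge ((q : ℤ) - w.m) 1 with hq1 | hq1
          · have : (C.b0 : ℤ) * ((q : ℤ) - w.m) ≤ 0 :=
              mul_nonpos_of_nonneg_of_nonpos (by positivity) (by omega)
            linarith
          · have : (C.b0 : ℤ) * 1 ≤ (C.b0 : ℤ) * ((q : ℤ) - w.m) :=
              mul_le_mul_of_nonneg_left hq1 (by positivity)
            linarith
    exact brick_cell hCmem hn1 hp hp41 hpn hsq w.m hx0 hx1 hk hzW hzV hzW' hzV' hzU hzU'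
  · exact absurd h Bool.false_ne_true

/-- **Soundness of the window check**: for a prime `p` of an `ok` window (`n ≥ 10496`), `p^k` divides the multiplied wedge
and the multiplied Q-minor. -/
theorem dvd_of_ok {w : BWin} (h : w.ok = true) (hn : 10496 ≤ n) (hp : p.Prime)
    (hlo : w.a1 * n < w.a2 * p) (hhi : w.b2 * p ≤ w.b1 * n)
    {zW zV zW' zV' zU zU' : ℤ}
    (hzW : dRec n ^ 3 * sharpNormaliser (bRecord n) * coeffW (bRecord n) = zW)
    (hzV : dRec n ^ 6 * sharpNormaliser (bRecord n) * coeffV (bRecord n) = zV)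
    (hzW' : dRec n ^ 3 * sharpNormaliser (bRecord' n) * coeffW (bRecord' n) = zW')
    (hzV' : dRec n ^ 6 * sharpNormaliser (bRecord' n) * coeffV (bRecord' n) = zV')
    (hzU : dRec n * sharpNormaliser (bRecord n) * coeffU (bRecord n) = zU)
    (hzU' : dRec n * sharpNormaliser (bRecord' n) * coeffU (bRecord' n) = zU') :
    (p : ℤ) ^ w.k ∣ (zW' * zV - zW * zV') ∧
    (p : ℤ) ^ w.k ∣ ((Nat.lcmUpto (41 * n) : ℤ) ^ 5 * (zU * zW') - (Nat.lcmUpto (41 * n) : ℤ) ^ 5 * (zU' * zW)) := by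
  simp only [ok, Bool.and_eq_true, Bool.or_eq_true] at h
  obtain ⟨hs, h | h⟩ := h
  · exact dvd_of_okAtlas hs h (by omega) hp hlo hhi hzW hzV hzW' hzV' hzU hzU'
  · exact dvd_of_okBrick hs h hn hp hlo hhi hzW hzV hzW' hzV' hzU hzU'

/-- An `ok` window has `0 ≤ A ≤ B` (over `ℝ`). -/
theorem Aq_le_Bq_of_ok {w : BWin} (h : w.ok = true) : (0 : ℝ) ≤ (w.Aq : ℝ) ∧ ((w.Aq : ℝ) : ℝ) ≤ (w.Bq : ℝ) := by
  simp only [ok, okShape, Bool.and_eq_true, decide_eq_true_eq] at h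
  obtain ⟨⟨⟨⟨⟨⟨-, ha2⟩, hb2⟩, hab⟩, -⟩, -⟩, -⟩ := h
  have ha2' : (0 : ℝ) < w.a2 := by exact_mod_cast ha2
  have hb2' : (0 : ℝ) < w.b2 := by exact_mod_cast hb2
  have hab' : (w.a1 : ℝ) * w.b2 ≤ w.b1 * w.a2 := by exact_mod_cast hab
  unfold Aq Bq
  push_cast
  exact ⟨by positivity, by rw [div_le_div_iff₀ ha2' hb2']; linarith⟩

/-- Integer form of `A·n < p` for an `ok` window. -/
theorem lo_nat_of_ok {w : BWin} (h : w.ok = true) (h1 : ((w.Aq : ℚ) : ℝ) * n < p) : w.a1 * n < w.a2 * p := by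
  simp only [ok, okShape, Bool.and_eq_true, decide_eq_true_eq] at h
  obtain ⟨⟨⟨⟨⟨⟨-, ha2⟩, -⟩, -⟩, -⟩, -⟩, -⟩ := h
  have ha2' : (0 : ℝ) < w.a2 := by exact_mod_cast ha2
  unfold Aq at h1
  push_cast at h1
  rw [div_mul_eq_mul_div, div_lt_iff₀ ha2'] at h1
  have : (w.a1 : ℝ) * n < w.a2 * p := by linarith
  exact_mod_cast this

/-- Integer form of `p ≤ B·n` for an `ok` window. -/
theorem hi_nat_of_ok {w : BWin} (h : w.ok = true) (h2 : (p : ℝ) ≤ ((w.Bq : ℚ) : ℝ) * n) : w.b2 * p ≤ w.b1 * n := by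
  simp only [ok, okShape, Bool.and_eq_true, decide_eq_true_eq] at h
  obtain ⟨⟨⟨⟨⟨⟨-, -⟩, hb2⟩, -⟩, -⟩, -⟩, -⟩ := h
  have hb2' : (0 : ℝ) < w.b2 := by exact_mod_cast hb2
  unfold Bq at h2
  push_cast at h2
  rw [div_mul_eq_mul_div, le_div_iff₀ hb2'] at h2
  have : (w.b2 : ℝ) * p ≤ w.b1 * n := by linarith
  exact_mod_cast this

end Sound

end BWin

end Summit.KontsevichZagierPeriods.Zeta5Search.RecordRay
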